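import Summits.AtomisticToContinuum.BoseEinsteinCondensation.Theses.BECStoquasticCensoring
import Literature.MathematicalPhysics.QuantumManyBody.BoseGasThermodynamicLimitRuelle

/-!
# `CountViolationGap` (stmt-AtomisticToContinuum-14968): reductions

The support item `BECStoquasticCensoring.CountViolationGap` (fixed-`K` violation gap: every Dirichlet trial state
that vanishes on the cell-count window `|N_Q − ρℓ³| ≤ M√(ρℓ³)` of one interior cell of side `ℓ = K(ρa)^(-1/2)` costs
`≥ E₀(N, L) + c₀·a·ρ·M²`, with `ρ₀` before `K`, `c₀` after `ρ`, the `N`-threshold after `K`) is the route's milestone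
and refutation proxy for the crux `CountViolationGapU` (stmt-AtomisticToContinuum-14966, the same body `K`-uniformly on
`K₀ ≤ K ≤ log N`). This file records the two soft reductions every attack on the item starts from:

* `countViolationGap_of_countViolationGapU` — the crux implies the support item (fix `K ≥ K₀`; eventually
  `K ≤ log N`, and the interior-cell hypothesis `ℓ ≤ x₀ₖ`, `x₀ₖ + 2ℓ ≤ L` gives the crux's side condition `3ℓ ≤ L`);
  `not_countViolationGapU_of_not_countViolationGap` is the contrapositive the refuters of 14966 cite.
* `countViolationGap_of_pos` — it suffices to prove the body for potentials with `0 < a < ∞`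
  (`a = scatteringLength v`): for `a.toReal = 0` the cell side `ℓ = K·(ρ·0)^(-1/2) = 0` vanishes (`Real.zero_rpow`),
  so the `M`-range `1 ≤ M`, `M² ≤ ρℓ³ = 0` is empty and the body holds vacuously; `a < ∞` is automatic for finite
  range (`IsRepulsiveFiniteRange.scatteringLength_ne_top`).

What is NOT here: the substantive case `0 < a < ∞`, an `N`-uniform `O(aρM²)` lower bound on the count-constrained
Dirichlet ground-state energy above `E₀(N, L)` — open (no printed control of `E₀(N, L)` or of constrained energies
to precision `o(N)`, let alone `O(aρ)`; LSSY2005 Thm. 2.4, FournaisSolovej2020).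

References: E. H. Lieb, R. Seiringer, J. P. Solovej, J. Yngvason, *The Mathematics of the Bose Gas and its
Condensation* (2005), §1.2, Ch. 2, App. C.
-/

noncomputable section

open Filter
open scoped ENNReal

namespace Summit.AtomisticToContinuum.BoseEinsteinCondensation.Theorems

open Literature.MathematicalPhysics.QuantumManyBody.BoseGas
open Summit.AtomisticToContinuum.BoseEinsteinCondensation.Theses.BECStoquasticCensoring
  (CountViolationGap CountViolationGapU)

/-- **The crux implies the milestone.** `CountViolationGapU` (the violation gap `K`-uniformly on
`K₀ ≤ K ≤ log N`, `N`-threshold before `K`) implies `CountViolationGap` (the same gap at each fixed `K ≥ K₀`,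
`N`-threshold after `K`): for fixed `K`, eventually `K ≤ log N`, and an interior cell (`ℓ ≤ x₀ₖ`, `x₀ₖ + 2ℓ ≤ L`)
forces `3ℓ ≤ L`. [folklore] -/
theorem countViolationGap_of_countViolationGapU (hU : CountViolationGapU) : CountViolationGap := by
  intro v hv
  obtain ⟨K₀, ρ₀, hρ₀, H⟩ := hU v hv
  refine ⟨K₀, ρ₀, hρ₀, fun ρ hρ hρlt => ?_⟩
  obtain ⟨c₀, hc₀, Hc⟩ := H ρ hρ hρlt
  refine ⟨c₀, hc₀, fun K hK => ?_⟩
  have hlog : ∀ᶠ N : ℕ in atTop, K ≤ Real.log N :=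
    (Real.tendsto_log_atTop.comp tendsto_natCast_atTop_atTop).eventually_ge_atTop K
  filter_upwards [Hc, hlog] with N hN hKlog
  intro a ℓ L x₀ hx₀ M hM hM2 Φ hΦ
  have h3 : 3 * ℓ ≤ L := by
    have h0 := hx₀ 0
    linarith [h0.1, h0.2]
  exact hN K hK hKlog h3 x₀ hx₀ M hM hM2 Φ hΦ

/-- **Refutation proxy.** A refutation of the fixed-`K` milestone refutes the crux `CountViolationGapU`
(contrapositive of `countViolationGap_of_countViolationGapU`). [folklore] -/
theorem not_countViolationGapU_of_not_countViolationGap (h : ¬ CountViolationGap) : ¬ CountViolationGapU :=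
  fun hU => h (countViolationGap_of_countViolationGapU hU)

/-- **Reduction to a positive, finite scattering length.** To prove `CountViolationGap` it suffices to prove its
body for the repulsive finite-range potentials with `scatteringLength v ≠ 0` and `≠ ⊤`: if `a = (scatteringLength
v).toReal = 0` then `ℓ = K·(ρ·a)^(-1/2) = 0`, so `ρℓ³ = 0 < 1 ≤ M²` contradicts `M² ≤ ρℓ³` and the body is vacuous
(any `K₀`, `ρ₀ = 1`, `c₀ = 1` do); and `scatteringLength v ≠ ⊤` holds for every finite-range `v`. [folklore] -/
theorem countViolationGap_of_pos
    (h : ∀ v : ℝ → ℝ≥0∞, IsRepulsiveFiniteRange v → scatteringLength v ≠ 0 → scatteringLength v ≠ ⊤ →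
      ∃ K₀ ρ₀ : ℝ, 0 < ρ₀ ∧ ∀ ρ : ℝ, 0 < ρ → ρ < ρ₀ → ∃ c₀ : ℝ, 0 < c₀ ∧ ∀ K : ℝ, K₀ ≤ K →
        ∀ᶠ N : ℕ in Filter.atTop,
          let a : ℝ := (scatteringLength v).toReal
          let ℓ : ℝ := K * (ρ * a) ^ (-(1 / 2 : ℝ))
          let L : ℝ := sideLength ρ N
          ∀ x₀ : EuclideanSpace ℝ (Fin 3), (∀ k, ℓ ≤ x₀ k ∧ x₀ k + 2 * ℓ ≤ L) → ∀ M : ℝ, 1 ≤ M →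
            M ^ 2 ≤ ρ * ℓ ^ 3 → ∀ Φ : TrialState N L,
              (∀ X : Config N,
                  |(∑ j : Fin N, ({x : EuclideanSpace ℝ (Fin 3) | ∀ k, x k ∈ Set.Ico (x₀ k) (x₀ k + ℓ)}).indicator
                      (fun _ => (1 : ℝ)) (X j)) - ρ * ℓ ^ 3| ≤ M * Real.sqrt (ρ * ℓ ^ 3) → Φ.ψ X = 0) →
                groundStateEnergy v N L + ENNReal.ofReal (c₀ * a * ρ * M ^ 2) ≤ energy v Φ) :
    CountViolationGap := by
  intro v hv
  by_cases ha : (scatteringLength v).toReal = 0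
  · -- degenerate branch: `ℓ = 0`, the `M`-range is empty
    refine ⟨0, 1, one_pos, fun ρ _ _ => ⟨1, one_pos, fun K _ => Filter.Eventually.of_forall fun N => ?_⟩⟩
    intro a ℓ L x₀ _ M hM hM2 Φ _
    exfalso
    have hℓ : ℓ = 0 := by
      show K * (ρ * (scatteringLength v).toReal) ^ (-(1 / 2 : ℝ)) = 0
      rw [ha, mul_zero, Real.zero_rpow (by norm_num), mul_zero]
    rw [hℓ] at hM2
    nlinarith
  · have hne : scatteringLength v ≠ 0 := fun h0 => ha (by rw [h0, ENNReal.toReal_zero])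
    have htop : scatteringLength v ≠ ⊤ := hv.scatteringLength_ne_top
    exact h v hv hne htop

/-! ### Compression witnesses (added 2026-08-16, prover seat pitem-14968-c1)

The physically optimal violation family for `CountViolationGap` is adiabatic compression/depletion of the cell
(cost `Δ²/(2χ_Q) ≈ 4πaρM²`, `K`-uniform — see the assessment attached to stmt-AtomisticToContinuum-14968), not a
cut-off of the ground state in the cell count. Its variational skeleton is the merged (symmetrised-product)
state of `n` particles confined inside `Q` and `N − n` confined away from `Q` (`SupportedState.merge` of the
Ruelle file): such a state has the SHARP count `N_Q = n`, so for `n` outside the window it is admissible in the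
item, and the item's constrained infimum is at most `E(n, U₁) + E(N − n, U₂)`. No asymptotics are claimed. -/

section CompressionWitness

variable {N₁ N₂ : ℕ} {U₁ U₂ Q : Set Space}

/-- **Cell count of an admissible relabelling.** If `σ` puts the first block of `X` into `U₁ ⊆ Q` and the
second block into `U₂` disjoint from `Q`, then exactly `N₁` particles of `X` lie in `Q`. [folklore] -/
theorem sum_indicator_eq_of_permAdm (hU₁ : U₁ ⊆ Q) (hU₂ : Disjoint U₂ Q)
    {σ : Equiv.Perm (Fin (N₁ + N₂))} {X : Config (N₁ + N₂)} (hσ : PermAdm N₁ N₂ U₁ U₂ σ X) :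
    (∑ j : Fin (N₁ + N₂), Q.indicator (fun _ => (1 : ℝ)) (X j)) = N₁ := by
  rw [← Equiv.sum_comp σ (fun j => Q.indicator (fun _ => (1 : ℝ)) (X j)), Fin.sum_univ_add]
  have h1 : ∀ i : Fin N₁, Q.indicator (fun _ => (1 : ℝ)) (X (σ (Fin.castAdd N₂ i))) = 1 := fun i =>
    Set.indicator_of_mem (hU₁ (hσ.1 i)) _
  have h2 : ∀ j : Fin N₂, Q.indicator (fun _ => (1 : ℝ)) (X (σ (Fin.natAdd N₁ j))) = 0 := fun j =>
    Set.indicator_of_notMem (Set.disjoint_left.1 hU₂ (hσ.2 j)) _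
  simp [h1, h2]

/-- Where the merged (symmetrised product) state of `Ψ₁` (supported in `U₁`) and `Ψ₂` (supported in `U₂`)
does not vanish, some relabelling is admissible. [folklore] -/
theorem exists_permAdm_of_merge_ne_zero (hdisj : Disjoint U₁ U₂) (Ψ₁ : SupportedState N₁ U₁)
    (Ψ₂ : SupportedState N₂ U₂) {X : Config (N₁ + N₂)} (hX : (Ψ₁.merge Ψ₂ hdisj).ψ X ≠ 0) :
    ∃ σ : Equiv.Perm (Fin (N₁ + N₂)), PermAdm N₁ N₂ U₁ U₂ σ X := by
  by_contra h
  push Not at h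
  apply hX
  show ((mergeScale N₁ N₂ : ℝ) : ℂ) * symSum Ψ₁ Ψ₂ X = 0
  rw [symSum, Finset.sum_eq_zero (fun σ _ => (permProd_eq_zero_of_not_permAdm Ψ₁ Ψ₂ (h σ)).1),
    mul_zero]

/-- **The merged state has a sharp cell count.** With `U₁ ⊆ Q` and `U₂ ∩ Q = ∅`, the merged state of
`N₁` particles in `U₁` and `N₂` particles in `U₂` vanishes at every configuration whose number of particles
in `Q` is not `N₁`. [folklore] -/
theorem merge_eq_zero_of_sum_indicator_ne (hdisj : Disjoint U₁ U₂) (hU₁ : U₁ ⊆ Q) (hU₂ : Disjoint U₂ Q)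
    (Ψ₁ : SupportedState N₁ U₁) (Ψ₂ : SupportedState N₂ U₂) {X : Config (N₁ + N₂)}
    (hX : (∑ j : Fin (N₁ + N₂), Q.indicator (fun _ => (1 : ℝ)) (X j)) ≠ N₁) :
    (Ψ₁.merge Ψ₂ hdisj).ψ X = 0 := by
  by_contra h
  obtain ⟨σ, hσ⟩ := exists_permAdm_of_merge_ne_zero hdisj Ψ₁ Ψ₂ h
  exact hX (sum_indicator_eq_of_permAdm hU₁ hU₂ hσ)

/-- **Compression-witness skeleton (block form).** For `v ≥ 0` measurable of range `≤ R`, regions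
`U₁ ⊆ Q ∩ Λ_L` and `U₂ ⊆ Λ_L ∖ Q` at mutual distance `> R ≥ 0`: the infimum of the energy over the
Dirichlet trial states of `N₁ + N₂` bosons in `Λ_L` that vanish unless EXACTLY `N₁` particles lie in `Q`
is at most `E(N₁, U₁) + E(N₂, U₂)` (merge near-minimisers of the two regions). [folklore] -/
theorem iInf_energy_countEq_le {v : ℝ → ℝ≥0∞} {R L : ℝ} (hv : Measurable v)
    (hv0 : ∀ r, R < r → v r = 0) (hR : 0 ≤ R) (hsep : ∀ x ∈ U₁, ∀ y ∈ U₂, R < dist x y)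
    (hU₁ : U₁ ⊆ Q) (hU₂ : Disjoint U₂ Q) (hU₁L : U₁ ⊆ box L) (hU₂L : U₂ ⊆ box L) :
    ⨅ (Φ : TrialState (N₁ + N₂) L)
      (_ : ∀ X, (∑ j : Fin (N₁ + N₂), Q.indicator (fun _ => (1 : ℝ)) (X j)) ≠ N₁ → Φ.ψ X = 0),
        energy v Φ ≤ infEnergy v N₁ U₁ + infEnergy v N₂ U₂ := by
  have hdisj : Disjoint U₁ U₂ := Set.disjoint_left.2 fun x hx1 hx2 => by
    have := hsep x hx1 x hx2
    rw [dist_self] at this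
    exact absurd this (not_lt.mpr hR)
  have hUL : U₁ ∪ U₂ ⊆ box L := Set.union_subset hU₁L hU₂L
  simp only [infEnergy]
  rw [ENNReal.iInf_add]
  refine le_iInf fun Φ₁ => ?_
  rw [ENNReal.add_iInf]
  refine le_iInf fun Φ₂ => ?_
  refine iInf₂_le_of_le ((Φ₁.merge Φ₂ hdisj).mono hUL).toTrialState
    (fun X hX => merge_eq_zero_of_sum_indicator_ne hdisj hU₁ hU₂ Φ₁ Φ₂ hX) (le_of_eq ?_)
  exact rawEnergy_merge Φ₁ Φ₂ hdisj hv hv0 hsep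

/-- **Compression-witness skeleton (general particle number).** As `iInf_energy_countEq_le`, for `N`
bosons of which exactly `n ≤ N` are confined to `Q`. [folklore] -/
theorem iInf_energy_countEq_le' {v : ℝ → ℝ≥0∞} {R L : ℝ} {N n : ℕ} (hn : n ≤ N) (hv : Measurable v)
    (hv0 : ∀ r, R < r → v r = 0) (hR : 0 ≤ R) (hsep : ∀ x ∈ U₁, ∀ y ∈ U₂, R < dist x y)
    (hU₁ : U₁ ⊆ Q) (hU₂ : Disjoint U₂ Q) (hU₁L : U₁ ⊆ box L) (hU₂L : U₂ ⊆ box L) :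
    ⨅ (Φ : TrialState N L)
      (_ : ∀ X, (∑ j : Fin N, Q.indicator (fun _ => (1 : ℝ)) (X j)) ≠ n → Φ.ψ X = 0),
        energy v Φ ≤ infEnergy v n U₁ + infEnergy v (N - n) U₂ := by
  obtain ⟨m, rfl⟩ : ∃ m, N = n + m := ⟨N - n, by omega⟩
  rw [Nat.add_sub_cancel_left]
  exact iInf_energy_countEq_le hv hv0 hR hsep hU₁ hU₂ hU₁L hU₂L

/-- **Compression witnesses for the violation gap.** If the prescribed count `n` lies OUTSIDE the window,
`M√(ρℓ³) < |n − ρℓ³|`, every trial state with sharp count `n` in `Q` vanishes on the window set of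
`CountViolationGap`; hence the constrained infimum of that item (energies of window-vanishing Dirichlet
states) is at most `E(n, U₁) + E(N − n, U₂)` for all admissible `U₁ ⊆ Q`, `U₂ ⊆ Λ_L ∖ Q`. This is the
variational skeleton of the adiabatic-compression family (the physically optimal violation, cost
`Δ²/(2χ_Q) ≈ 4πaρM²`); it carries no asymptotics. [folklore] -/
theorem iInf_energy_windowVanishing_le {v : ℝ → ℝ≥0∞} {R L ρ ℓ M : ℝ} {N n : ℕ} (hn : n ≤ N)
    (hv : Measurable v) (hv0 : ∀ r, R < r → v r = 0) (hR : 0 ≤ R)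
    (hsep : ∀ x ∈ U₁, ∀ y ∈ U₂, R < dist x y) (hU₁ : U₁ ⊆ Q) (hU₂ : Disjoint U₂ Q)
    (hU₁L : U₁ ⊆ box L) (hU₂L : U₂ ⊆ box L) (hout : M * Real.sqrt (ρ * ℓ ^ 3) < |(n : ℝ) - ρ * ℓ ^ 3|) :
    ⨅ (Φ : TrialState N L)
      (_ : ∀ X : Config N, |(∑ j : Fin N, Q.indicator (fun _ => (1 : ℝ)) (X j)) - ρ * ℓ ^ 3| ≤
        M * Real.sqrt (ρ * ℓ ^ 3) → Φ.ψ X = 0),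
        energy v Φ ≤ infEnergy v n U₁ + infEnergy v (N - n) U₂ := by
  refine le_trans ?_ (iInf_energy_countEq_le' hn hv hv0 hR hsep hU₁ hU₂ hU₁L hU₂L)
  refine le_iInf₂ fun Φ hΦ => iInf₂_le Φ fun X hX => hΦ X fun hcount => ?_
  rw [hcount] at hX
  exact absurd (hX.trans_lt hout) (lt_irrefl _)

end CompressionWitness

end Summit.AtomisticToContinuum.BoseEinsteinCondensation.Theorems

end
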